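import Summits.SmoothPoincare4.SmoothPoincare4.Theorems.ConvexBisectionAcyclicBisectionExistsDualHandlePush
import Summits.SmoothPoincare4.SmoothPoincare4.Theorems.ConvexBisectionAcyclicBisectionExistsDualHandleModelEmbDom
import HarnessLib

/-!
# The seam page function, I: the swap symmetry of the model maps inside the dual tubes
(brick X5-1 (model part) of clause (ii) "the seam page function `F : ∂X₁ → ℂ`" of the registered stub
`stub_T3_dualPresentation` (T3), line `modp-braid-orbits`, crux `ConvexBisection.AcyclicBisectionExists`,
item stmt-SmoothPoincare4-10508; wave 5, lead c5)

Clause (ii-c) of T3 asks the seam page function to be a positive multiple of `w(a')` at EVERY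
`W₂`-unsurgered seam point, including those inside the dual attaching tubes, where the new seam is the
graph `{H = 0}` inside the `j`-th handle chart (Z2/Z3) and a point is read TWICE: through the pushed
prefix embedding (`X`-reading, `jX₁' (ḡ_j t) = jM (D.jB j (modelPush κ δ (α t)))`, Y5 clause (b) with
`α ∘ selfPush = modelPush ∘ α`) and through the dual handle (`W`-reading,
`jW₂ (D₂.jB j (α y')) = chart_j (modelF a κ δ (α y'))`, the dual tube point being `dualMap_j y'` with
`jN (dualMap_j y') = modelChart (dualVec a κ δ y')`).  The two readings name THE SAME point of the
attaching tube of the base iff `α t = dualVec a κ δ y'`, and this file proves exactly that: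

* `FTop_one`, `ridge_sq_mul`, `pushP_ridge_eq_pFun` — the `(P, Q)`-profile identities
  `F(s,1) = 1 - κ² s`, `ridge κ δ (κ² s) = s q̃(s,1)`, `pushP κ (κ² s) (ridge(κ² s)/δ) = pFun κ s`;
* **`modelPush_dualVec`**: for `y' ∈ T ∩ ∂D⁴` off `S`,
  `modelPush κ δ (dualVec a κ δ y') = modelF a κ δ (α y')` (both have `λ`-direction `ŷ'_μ`,
  `μ`-direction `ŷ'_λ`, `P = pFun κ s`, `Q = s q̃(s,1)`, `s = 1 - ‖y'_λ‖²`) — Kosinski's swap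
  symmetry `λ ↔ μ` of `α` on `∂D⁴` survives the landed push and the landed dual handle model ON THE
  NOSE, for the same constants `κ, δ` in `dualMap` and in `modelF`/`selfPush`;
* `eq_dualVec_of_modelPush_eq` — hence `modelPush κ δ x = modelF a κ δ (α y')`, `x_λ ≠ 0`, forces
  `x = dualVec a κ δ y'` (injectivity of the push);
* `helper_modelPush_dualVec` (registered).

Everything here is proved (pure `ℝ⁴` algebra); no named facts.

## References
* A. A. Kosinski, *Differential Manifolds* (1993), VI §6, (6.1). [Kosinski1993]
* J. Milnor, *Lectures on the h-cobordism theorem* (1965), §3. [MilnorHCobordism1965]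
-/

noncomputable section

-- the prescribed namespace `Summit.<P>.<Sub>.…` duplicates `SmoothPoincare4` (P = Sub)
set_option linter.dupNamespace false

open scoped Manifold ContDiff Topology

namespace Summit.SmoothPoincare4.SmoothPoincare4.Theorems.AcyclicBisectionExists.ModpBraidOrbits

open Set Function Metric
open Literature.Topology.FourManifolds Literature.Topology.FourManifolds.HandleAttachingMap
open PushModel

/-! ### §1 The `(P, Q)`-profile identities along the cone line `P = κ² s` -/

section Scalars

variable {a κ δ : ℝ}

/-- `F(s, 1) = 1 - κ² s` (no `W`-depth at `u = 1`). [folklore] -/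
theorem FTop_one (a κ δ s : ℝ) : FTop a κ δ s 1 = 1 - κ ^ 2 * s := by
  simp [FTop, gProfile]

/-- **The ridge over the cone line is the `μ`-profile of the model map**:
`ridge κ δ (κ² s) = s q̃(s, 1)`. [folklore] -/
theorem ridge_sq_mul (hκ : 0 < κ) (a δ s : ℝ) : ridge κ δ (κ ^ 2 * s) = s * qTilde a κ δ s 1 := by
  have hκ0 : κ ^ 2 ≠ 0 := by positivity
  have h1 : κ ^ 2 * s / κ ^ 2 = s := by field_simp
  have h2 : δ * (κ ^ 2 * s) / κ ^ 2 = δ * s := by field_simp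
  rw [ridge, h1, h2, sq_qTilde_eq, FTop_one]

/-- **The push maps the cone line over the ridge onto the floor of `N`**:
`pushP κ (κ² s) (ridge(κ² s)/δ) = pFun κ s` for `s ≥ 0` (`pushP_base` below `s = 1/2`, where the ridge is
the cone line `δ s`; the identity above, where both sides are `κ² s`). [folklore] -/
theorem pushP_ridge_eq_pFun (hκ : 0 < κ) (hδ : 0 < δ) (s : ℝ) :
    pushP κ (κ ^ 2 * s) (ridge κ δ (κ ^ 2 * s) / δ) = pFun κ s := by
  have hκ0 : κ ≠ 0 := hκ.ne'
  have hδ0 : δ ≠ 0 := hδ.ne'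
  rcases lt_or_ge s (1 / 2) with h | h
  · have hP : κ ^ 2 * s ≤ κ ^ 2 / 2 := by nlinarith [sq_nonneg κ]
    rw [ridge_of_le hκ hP]
    have : δ * (κ ^ 2 * s) / κ ^ 2 / δ = s := by field_simp
    rw [this, pushP_base hκ]
  · have hP : κ ^ 2 / 2 ≤ κ ^ 2 * s := by nlinarith [sq_nonneg κ]
    rw [pushP_of_ge _ hP, pFun_of_ge κ (by linarith)]

end Scalars

/-! ### §2 The swap symmetry: `modelPush ∘ dualVec = modelF ∘ α` on `T ∩ ∂D⁴` -/

section Swap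

variable {a κ δ : ℝ}

/-- A vector of `ℝ⁴` is determined by its `λ`- and `μ`-parts. [folklore] -/
theorem eq_of_parts_eq {x y : EuclideanSpace ℝ (Fin 4)} (hl : lamPart x = lamPart y)
    (hm : muPart x = muPart y) : x = y := by
  rw [← lamEmbed_add_muEmbed x, ← lamEmbed_add_muEmbed y, hl, hm]

/-- On `T ∩ ∂D⁴`: `‖y_μ‖² = 1 - ‖y_λ‖²`. [folklore] -/
theorem norm_tubeFibre_sq_of_depth_zero (y : ↥(handleTube 3 2)) (hd : tubeDepth y = 0) :
    ‖tubeFibre y‖ ^ 2 = 1 - lamSq 2 (tubeVec y) := by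
  have h := norm_lamPart_sq_eq y
  rw [hd, norm_lamPart_sq] at h
  linarith

/-- **THE SWAP SYMMETRY.**  For `y ∈ T ∩ ∂D⁴` off the attaching sphere (`‖y_λ‖² < 1`),
`modelPush κ δ (dualVec a κ δ y) = modelF a κ δ (α y)`: with `s' = ‖y_λ‖²`, `s = 1 - s'`, the left side
is the push of `(κ y_μ, √(1 - κ² s) ŷ_λ)` (`P = κ² s`, `Q = 1 - κ² s`), i.e.
`(√(pFun κ s/(κ² s)) κ y_μ, √(muScaleSq (κ² s) (1 - κ² s)) ŷ_λ)`; the right side is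
`(√(pFun κ s/s') · √(s'/s) y_μ, √(q̃(s,1)) √(s/s') y_λ)` (`uOf (α y) = 1`); the `λ`-coefficients are both
`√(pFun κ s / s)` and the `μ`-coefficients both `√(s q̃(s,1))/√s'` by `pushP_ridge_eq_pFun`,
`one_sub_mul_muScaleSq` and `ridge_sq_mul`. [cite: Kosinski1993, VI §6] -/
theorem modelPush_dualVec (ha : 0 < a) (hκ : 0 < κ) (hκ2 : κ ≤ 1 / 2) (hδ : 0 < δ) (hδ2 : δ ≤ 1 / 2)
    (y : ↥(handleTube 3 2)) (hd : tubeDepth y = 0) (hS : lamSq 2 (tubeVec y) < 1) :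
    modelPush κ δ (dualVec a κ δ y) = modelF a κ δ (handleInversion 2 (tubeVec y)) := by
  -- coordinates
  set Y := tubeVec y with hY
  set s' := lamSq 2 Y with hs'
  have hs'0 : 0 < s' := lamSq_tubeVec_pos y
  set s := 1 - s' with hs
  have hs0 : 0 < s := by rw [hs]; linarith
  have hs1 : s < 1 := by rw [hs]; linarith
  have hfib2 : ‖tubeFibre y‖ ^ 2 = s := norm_tubeFibre_sq_of_depth_zero y hd
  have hfib : tubeFibre y = muPart Y := rfl
  have hmu2 : ‖muPart Y‖ ^ 2 = s := hfib ▸ hfib2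
  have hlamn : ‖lamPart Y‖ = Real.sqrt s' := by
    rw [← Real.sqrt_sq (norm_nonneg (lamPart Y)), norm_lamPart_sq]
  have hmun : ‖muPart Y‖ = Real.sqrt s := by
    rw [← Real.sqrt_sq (norm_nonneg (muPart Y)), hmu2]
  have hmu0 : muPart Y ≠ 0 := by
    intro h0; rw [h0, norm_zero] at hmun
    exact (Real.sqrt_pos.2 hs0).ne' hmun.symm
  have hκs0 : 0 < κ ^ 2 * s := by positivity
  have hκs1 : κ ^ 2 * s < 1 := by
    have : κ ^ 2 ≤ 1 / 4 := by nlinarith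
    nlinarith
  -- the dual vector `x₂ = (κ y_μ, R ŷ_λ)`
  set x₂ := dualVec a κ δ y with hx₂
  have hR : Real.sqrt (1 + gProfile a (δ * tubeDepth y) - κ ^ 2 * ‖tubeFibre y‖ ^ 2) =
      Real.sqrt (1 - κ ^ 2 * s) := by
    rw [hd, hfib2, mul_zero]
    simp [gProfile]
  have hl₂ : lamPart x₂ = κ • muPart Y := by rw [hx₂, lamPart_dualVec, hfib]
  have hm₂ : muPart x₂ = (Real.sqrt (1 - κ ^ 2 * s) * (Real.sqrt s')⁻¹) • lamPart Y := by
    rw [hx₂, muPart_dualVec, hR, coe_tubeAngle, smul_smul, ← hY, hlamn]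
  have hP₂ : sOf x₂ = κ ^ 2 * s := by
    rw [sOf, hl₂, norm_smul, mul_pow, Real.norm_of_nonneg hκ.le, hmu2]
  have hQ₂ : muN x₂ = 1 - κ ^ 2 * s := by
    rw [muN, hm₂, norm_smul, mul_pow, Real.norm_of_nonneg (mul_nonneg (Real.sqrt_nonneg _)
      (inv_nonneg.2 (Real.sqrt_nonneg _))), mul_pow, inv_pow, hlamn, Real.sq_sqrt hs'0.le,
      Real.sq_sqrt (by linarith), mul_assoc, inv_mul_cancel₀ hs'0.ne', mul_one]
  have hl₂0 : lamPart x₂ ≠ 0 := by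
    rw [hl₂]; exact smul_ne_zero hκ.ne' hmu0
  -- the push of `x₂`
  have hridge : muScaleSq κ δ (κ ^ 2 * s) * (1 - κ ^ 2 * s) = ridge κ δ (κ ^ 2 * s) := by
    rw [mul_comm]; exact one_sub_mul_muScaleSq hκ hκs1
  have hpush : pushP κ (sOf x₂) (muScaleSq κ δ (sOf x₂) * muN x₂ / δ) = pFun κ s := by
    rw [hP₂, hQ₂, hridge, pushP_ridge_eq_pFun hκ hδ s]
  have hLl : lamPart (modelPush κ δ x₂) = (Real.sqrt (pFun κ s / (κ ^ 2 * s)) * κ) • muPart Y := by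
    rw [modelPush, lamPart_torusScale, hpush, hP₂, hl₂, smul_smul]
  have hLm : muPart (modelPush κ δ x₂) =
      (Real.sqrt (muScaleSq κ δ (κ ^ 2 * s)) * (Real.sqrt (1 - κ ^ 2 * s) * (Real.sqrt s')⁻¹)) •
        lamPart Y := by
    rw [modelPush, muPart_torusScale, hP₂, hm₂, smul_smul]
  -- the inverted point `α Y`
  set Z := handleInversion 2 Y with hZ
  have hsZ : sOf Z = s := by rw [sOf_eq_lamSq, hZ, lamSq_handleInversion hs'0 hS.le]
  have hlZ : lamPart Z = (Real.sqrt s / Real.sqrt s') • lamPart Y := by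
    rw [hZ, lamPart_handleInversion]
  have hmZ : muPart Z = (Real.sqrt s' / Real.sqrt s) • muPart Y := by
    rw [hZ, muPart_handleInversion]
  have h1s : 1 - s = s' := by rw [hs]; ring
  have huZ : uOf Z = 1 := by
    rw [uOf, hsZ, hmZ, norm_smul, mul_pow, Real.norm_of_nonneg (div_nonneg (Real.sqrt_nonneg _)
      (Real.sqrt_nonneg _)), div_pow, Real.sq_sqrt hs'0.le, Real.sq_sqrt hs0.le, hmu2, h1s]
    field_simp
  have hRl : lamPart (modelF a κ δ Z) = (Real.sqrt (pFun κ s / (1 - s)) * (Real.sqrt s' / Real.sqrt s)) •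
      muPart Y := by
    rw [lamPart_modelF, hsZ, hmZ, smul_smul]
  have hRm : muPart (modelF a κ δ Z) = (Real.sqrt (qTilde a κ δ s 1) * (Real.sqrt s / Real.sqrt s')) •
      lamPart Y := by
    rw [muPart_modelF, hsZ, huZ, hlZ, smul_smul]
  -- compare the coefficients
  have hpF : 0 ≤ pFun κ s := (pFun_pos hκ hs0.le).le
  have hq : 0 ≤ qTilde a κ δ s 1 :=
    (qTilde_pos ha hκ hκ2 hδ hδ2 hs0.le hs1 zero_le_one le_rfl).le
  have key : muScaleSq κ δ (κ ^ 2 * s) * (1 - κ ^ 2 * s) = s * qTilde a κ δ s 1 :=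
    hridge.trans (ridge_sq_mul hκ a δ s)
  refine eq_of_parts_eq ?_ ?_
  · rw [hLl, hRl]
    congr 1
    refine (sq_eq_sq₀ (by positivity) (by positivity)).1 ?_
    rw [mul_pow, mul_pow, div_pow, Real.sq_sqrt (by positivity), Real.sq_sqrt (by positivity),
      Real.sq_sqrt hs'0.le, Real.sq_sqrt hs0.le, h1s]
    field_simp
  · rw [hLm, hRm]
    congr 1
    refine (sq_eq_sq₀ (by positivity) (by positivity)).1 ?_
    have hms : 0 ≤ muScaleSq κ δ (κ ^ 2 * s) := (muScaleSq_pos hκ hκ2 hδ hκs0).le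
    rw [mul_pow, mul_pow, mul_pow, div_pow, inv_pow, Real.sq_sqrt hms, Real.sq_sqrt (by linarith),
      Real.sq_sqrt hs'0.le, Real.sq_sqrt hq, Real.sq_sqrt hs0.le,
      show muScaleSq κ δ (κ ^ 2 * s) * ((1 - κ ^ 2 * s) * s'⁻¹) =
        (muScaleSq κ δ (κ ^ 2 * s) * (1 - κ ^ 2 * s)) * s'⁻¹ by ring, key]
    field_simp

/-- The `λ`-part of the dual vector of a boundary tube point off `S` is non-zero. [folklore] -/
theorem lamPart_dualVec_ne_zero (hκ : 0 < κ) (y : ↥(handleTube 3 2)) (hd : tubeDepth y = 0)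
    (hS : lamSq 2 (tubeVec y) < 1) : lamPart (dualVec a κ δ y) ≠ 0 := by
  rw [lamPart_dualVec]
  refine smul_ne_zero hκ.ne' fun h0 => ?_
  have h := norm_tubeFibre_sq_of_depth_zero y hd
  rw [h0, norm_zero] at h
  have h2 : (0 : ℝ) ^ 2 = 0 := by norm_num
  linarith

/-- **Consequence (injectivity of the push)**: if `modelPush κ δ x = modelF a κ δ (α y')` for some
`x` with `x_λ ≠ 0` and a boundary tube point `y'` off `S`, then `x = dualVec a κ δ y'`. [folklore] -/
theorem eq_dualVec_of_modelPush_eq (ha : 0 < a) (hκ : 0 < κ) (hκ2 : κ ≤ 1 / 2) (hδ : 0 < δ)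
    (hδ2 : δ ≤ 1 / 2) {x : EuclideanSpace ℝ (Fin 4)} (hx : lamPart x ≠ 0) (y : ↥(handleTube 3 2))
    (hd : tubeDepth y = 0) (hS : lamSq 2 (tubeVec y) < 1)
    (h : modelPush κ δ x = modelF a κ δ (handleInversion 2 (tubeVec y))) : x = dualVec a κ δ y := by
  rw [← modelPush_dualVec ha hκ hκ2 hδ hδ2 y hd hS] at h
  have h1 := modelPushInv_modelPush hκ hκ2 hδ hx (δ := δ)
  rw [h, modelPushInv_modelPush hκ hκ2 hδ (lamPart_dualVec_ne_zero hκ y hd hS)] at h1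
  exact h1.symm

end Swap

/-! ### §3 Registered helper -/

/-- **Registered helper `helper_modelPush_dualVec` (sub-goal of `stub_T3_dualPresentation` (T3 clause
(ii), X5-1 model part), wave 5, lead c5): the swap symmetry of the model maps inside the dual tubes** —
for `y ∈ T ∩ ∂D⁴` with `‖y_λ‖² < 1`, `modelPush κ δ (dualVec a κ δ y) = modelF a κ δ (α y)`.
[cite: Kosinski1993, VI §6] -/
theorem helper_modelPush_dualVec : ∀ {a κ δ : ℝ}, 0 < a → 0 < κ → κ ≤ 1 / 2 → 0 < δ → δ ≤ 1 / 2 → ∀ (y : ↥(Literature.Topology.FourManifolds.handleTube 3 2)), Literature.Topology.FourManifolds.tubeDepth y = 0 → Literature.Topology.FourManifolds.lamSq 2 (Literature.Topology.FourManifolds.tubeVec y) < 1 → Summit.SmoothPoincare4.SmoothPoincare4.Theorems.AcyclicBisectionExists.ModpBraidOrbits.PushModel.modelPush κ δ (Summit.SmoothPoincare4.SmoothPoincare4.Theorems.AcyclicBisectionExists.ModpBraidOrbits.dualVec a κ δ y) = Summit.SmoothPoincare4.SmoothPoincare4.Theorems.AcyclicBisectionExists.ModpBraidOrbits.modelF a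 κ δ (Literature.Topology.FourManifolds.handleInversion 2 (Literature.Topology.FourManifolds.tubeVec y)) :=
  fun ha hκ hκ2 hδ hδ2 y hd hS => modelPush_dualVec ha hκ hκ2 hδ hδ2 y hd hS

end Summit.SmoothPoincare4.SmoothPoincare4.Theorems.AcyclicBisectionExists.ModpBraidOrbits

end
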